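import Summits.CriticalPhenomena.PercolationContinuityZ3.Theorems.SahiMasterFamilyPointwiseCoordinateGluingBlocks

/-!
# One-coordinate gluing, IV: a pair independent on EACH side of a coordinate, absorbed by the third member on the `1`-side — a short
# identity, `C_3` unconditionally and the pointwise zero locus

Unit `prim-master-conj` (crux anchor stmt-CriticalPhenomena-4575, helper work), gen 15; memo
`run/shared/lean/prim/prim-l12/prim-master-conj/POINTWISE.md` §16.  Notation: `t = p_e`, `X^b = secAt e b X`, `m = μ_p`, `ν_X = m X¹ − m X⁰`,
`C = D⁰`, `G = D¹`.

THE CLASS (supersedes part III, `…CoordinateGluingBlocks`, whose block hypothesis forces the same split on both sides): increasing `A, B, D` and a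
coordinate `e` with
 * `A⁰ ⟂ B⁰` (the `0`-sections have disjoint determining sets `F₀ / F₀ᶜ`) and `A¹ ⟂ B¹` (sets `F₁ / F₁ᶜ`, possibly a DIFFERENT split), and
 * `D¹ ⊇ A¹ ∪ B¹` (the third member absorbs the other two on the half-cube `{e ∈ ω}`; `D⁰ = C` is free).
THE IDENTITY (`sahiE_three_absorbedPair_eq`):
  `E_3(A, B, D) = (1−t)·[Cov(A⁰, B⁰∩C) + Cov(B⁰, A⁰∩C)] + t(1−t)·[(2 − m G)·ν_A ν_B + ν_A·m(B⁰ ∖ C) + ν_B·m(A⁰ ∖ C)] + t(1−t)²·ν_A ν_B·(m G − m C)`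
(the first bracket is `E_3(A⁰, B⁰, C)` for an independent pair).  Seven nonnegative transferable atoms ⟹ `sahiE_three_absorbedPair_nonneg` (`C_3` on
the class at every `p`) and `sahiE_three_absorbedPair_settled` (`E_3 = 0 ↔ Z_3` at interior `p`; positivity is the previous theorem).  The `n = 5` census of memo §16 (77 non-degenerate
good-coordinate classes) consists of triples whose `1`-minor has exactly this absorbing shape; the present file settles those whose `0`-sections of the
pair are also independent, the rest (dependent `A⁰, B⁰` inside a zero-flag `0`-minor) is recorded in the memo with its mixed-coefficient formula.
HONEST FRAMING: a class theorem; Kahn's Conjecture 5 / `MasterFamilyEqIff 3` remain OPEN.  Axioms standard. [this work]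
-/

noncomputable section

open scoped Classical

namespace Summit.CriticalPhenomena.PercolationContinuityZ3.Theorems

open Finset Function
open Literature.Combinatorics.Sahi2008
open Literature.Probability.Percolation (DeterminedBy)
open Literature.Probability.Percolation.DecisionTree (ind ind_of_mem ind_of_not_mem ind_nonneg)
open SahiCombDisjunct

namespace Pointwise

variable {ι : Type} [Fintype ι]

section AbsorbedPair

variable (p : ι → unitInterval) (e : ι) (F₀ F₁ : Finset ι) (A B D : Set (Set ι))
  (hA0 : DeterminedBy (secAt e false A) (↑F₀ : Set ι)) (hB0 : DeterminedBy (secAt e false B) (↑F₀ : Set ι)ᶜ)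
  (hA1 : DeterminedBy (secAt e true A) (↑F₁ : Set ι)) (hB1 : DeterminedBy (secAt e true B) (↑F₁ : Set ι)ᶜ)
  (hDA : secAt e true A ⊆ secAt e true D) (hDB : secAt e true B ⊆ secAt e true D)
include hA0 hB0 hA1 hB1 hDA hDB

/-- **Identity (D): independent pair on each side of `e`, absorbed on the `1`-side.** [this work] -/
theorem sahiE_three_absorbedPair_eq :
    sahiE (bernoulliWeight p) 3 ![ind A, ind B, ind D] =
      (1 - (p e : ℝ)) *
        ((ex (bernoulliWeight p) (ind (secAt e false A ∩ (secAt e false B ∩ secAt e false D))) -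
            ex (bernoulliWeight p) (ind (secAt e false A)) * ex (bernoulliWeight p) (ind (secAt e false B ∩ secAt e false D)))
          + (ex (bernoulliWeight p) (ind (secAt e false B ∩ (secAt e false A ∩ secAt e false D))) -
            ex (bernoulliWeight p) (ind (secAt e false B)) * ex (bernoulliWeight p) (ind (secAt e false A ∩ secAt e false D))))
      + (p e : ℝ) * (1 - (p e : ℝ)) *
        ((2 - ex (bernoulliWeight p) (ind (secAt e true D))) *
            ((ex (bernoulliWeight p) (ind (secAt e true A)) - ex (bernoulliWeight p) (ind (secAt e false A))) *
              (ex (bernoulliWeight p) (ind (secAt e true B)) - ex (bernoulliWeight p) (ind (secAt e false B))))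
          + (ex (bernoulliWeight p) (ind (secAt e true A)) - ex (bernoulliWeight p) (ind (secAt e false A))) *
            (ex (bernoulliWeight p) (ind (secAt e false B)) - ex (bernoulliWeight p) (ind (secAt e false B ∩ secAt e false D)))
          + (ex (bernoulliWeight p) (ind (secAt e true B)) - ex (bernoulliWeight p) (ind (secAt e false B))) *
            (ex (bernoulliWeight p) (ind (secAt e false A)) - ex (bernoulliWeight p) (ind (secAt e false A ∩ secAt e false D))))
      + (p e : ℝ) * (1 - (p e : ℝ)) ^ 2 *
        ((ex (bernoulliWeight p) (ind (secAt e true A)) - ex (bernoulliWeight p) (ind (secAt e false A))) *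
          (ex (bernoulliWeight p) (ind (secAt e true B)) - ex (bernoulliWeight p) (ind (secAt e false B))) *
          (ex (bernoulliWeight p) (ind (secAt e true D)) - ex (bernoulliWeight p) (ind (secAt e false D)))) := by
  have hAe : ex (bernoulliWeight p) (ind A) = (p e : ℝ) * ex (bernoulliWeight p) (ind (secAt e true A)) +
      (1 - (p e : ℝ)) * ex (bernoulliWeight p) (ind (secAt e false A)) := ex_ind_eq_secAt p e A
  have hBe : ex (bernoulliWeight p) (ind B) = (p e : ℝ) * ex (bernoulliWeight p) (ind (secAt e true B)) +
      (1 - (p e : ℝ)) * ex (bernoulliWeight p) (ind (secAt e false B)) := ex_ind_eq_secAt p e B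
  have hDe : ex (bernoulliWeight p) (ind D) = (p e : ℝ) * ex (bernoulliWeight p) (ind (secAt e true D)) +
      (1 - (p e : ℝ)) * ex (bernoulliWeight p) (ind (secAt e false D)) := ex_ind_eq_secAt p e D
  have hAB : ex (bernoulliWeight p) (ind (A ∩ B)) = (p e : ℝ) * ex (bernoulliWeight p) (ind (secAt e true A ∩ secAt e true B)) +
      (1 - (p e : ℝ)) * ex (bernoulliWeight p) (ind (secAt e false A ∩ secAt e false B)) := by
    rw [ex_ind_eq_secAt p e (A ∩ B), secAt_inter, secAt_inter]
  have hAD : ex (bernoulliWeight p) (ind (A ∩ D)) = (p e : ℝ) * ex (bernoulliWeight p) (ind (secAt e true A ∩ secAt e true D)) +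
      (1 - (p e : ℝ)) * ex (bernoulliWeight p) (ind (secAt e false A ∩ secAt e false D)) := by
    rw [ex_ind_eq_secAt p e (A ∩ D), secAt_inter, secAt_inter]
  have hBD : ex (bernoulliWeight p) (ind (B ∩ D)) = (p e : ℝ) * ex (bernoulliWeight p) (ind (secAt e true B ∩ secAt e true D)) +
      (1 - (p e : ℝ)) * ex (bernoulliWeight p) (ind (secAt e false B ∩ secAt e false D)) := by
    rw [ex_ind_eq_secAt p e (B ∩ D), secAt_inter, secAt_inter]
  have hABD : ex (bernoulliWeight p) (ind (A ∩ B ∩ D)) =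
      (p e : ℝ) * ex (bernoulliWeight p) (ind (secAt e true A ∩ secAt e true B ∩ secAt e true D)) +
      (1 - (p e : ℝ)) * ex (bernoulliWeight p) (ind (secAt e false A ∩ secAt e false B ∩ secAt e false D)) := by
    rw [ex_ind_eq_secAt p e (A ∩ B ∩ D), secAt_inter, secAt_inter, secAt_inter, secAt_inter]
  have f00 : ex (bernoulliWeight p) (ind (secAt e false A ∩ secAt e false B)) =
      ex (bernoulliWeight p) (ind (secAt e false A)) * ex (bernoulliWeight p) (ind (secAt e false B)) :=
    ex_ind_inter_of_separated p F₀ hA0 hB0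
  have f11 : ex (bernoulliWeight p) (ind (secAt e true A ∩ secAt e true B)) =
      ex (bernoulliWeight p) (ind (secAt e true A)) * ex (bernoulliWeight p) (ind (secAt e true B)) :=
    ex_ind_inter_of_separated p F₁ hA1 hB1
  have g1 : ex (bernoulliWeight p) (ind (secAt e true A ∩ secAt e true D)) = ex (bernoulliWeight p) (ind (secAt e true A)) :=
    ex_ind_inter_of_subset _ hDA
  have g2 : ex (bernoulliWeight p) (ind (secAt e true B ∩ secAt e true D)) = ex (bernoulliWeight p) (ind (secAt e true B)) :=
    ex_ind_inter_of_subset _ hDB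
  have g3 : ex (bernoulliWeight p) (ind (secAt e true A ∩ secAt e true B ∩ secAt e true D)) =
      ex (bernoulliWeight p) (ind (secAt e true A)) * ex (bernoulliWeight p) (ind (secAt e true B)) := by
    rw [Set.inter_eq_left.2 (Set.inter_subset_left.trans hDA), f11]
  -- the `0`-side triple moment, in the two bracketings used on the right
  have s1 : secAt e false A ∩ (secAt e false B ∩ secAt e false D) = secAt e false A ∩ secAt e false B ∩ secAt e false D :=
    (Set.inter_assoc _ _ _).symm
  have s2 : secAt e false B ∩ (secAt e false A ∩ secAt e false D) = secAt e false A ∩ secAt e false B ∩ secAt e false D := by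
    ext ω; simp only [Set.mem_inter_iff]; tauto
  rw [s1, s2, sahiE_three]
  simp only [ind_mul_ind_eq_inter]
  rw [hAe, hBe, hDe, hAB, hAD, hBD, hABD, f00, f11, g1, g2, g3]
  ring

variable (hAu : IsUpperSet A) (hBu : IsUpperSet B) (hDu : IsUpperSet D)
include hAu hBu hDu

/-- **`C_3` on the class, every `p ∈ [0,1]^ι`, unconditionally.** [this work] -/
theorem sahiE_three_absorbedPair_nonneg : 0 ≤ sahiE (bernoulliWeight p) 3 ![ind A, ind B, ind D] := by
  rw [sahiE_three_absorbedPair_eq p e F₀ F₁ A B D hA0 hB0 hA1 hB1 hDA hDB]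
  have ht0 : 0 ≤ (p e : ℝ) := (p e).2.1
  have ht1 : 0 ≤ 1 - (p e : ℝ) := sub_nonneg.2 (p e).2.2
  have hA0u := isUpperSet_secAt e false hAu
  have hB0u := isUpperSet_secAt e false hBu
  have hC := isUpperSet_secAt e false hDu
  have c1 := cov_ind_nonneg p hA0u (hB0u.inter hC)
  have c2 := cov_ind_nonneg p hB0u (hA0u.inter hC)
  have nA := ex_secAt_true_sub_false_nonneg p e hAu
  have nB := ex_secAt_true_sub_false_nonneg p e hBu
  have nD := ex_secAt_true_sub_false_nonneg p e hDu
  have dB : 0 ≤ ex (bernoulliWeight p) (ind (secAt e false B)) - ex (bernoulliWeight p) (ind (secAt e false B ∩ secAt e false D)) := by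
    rw [ex_ind_sub_of_subset _ Set.inter_subset_left]; exact ex_ind_nonneg' p _
  have dA : 0 ≤ ex (bernoulliWeight p) (ind (secAt e false A)) - ex (bernoulliWeight p) (ind (secAt e false A ∩ secAt e false D)) := by
    rw [ex_ind_sub_of_subset _ Set.inter_subset_left]; exact ex_ind_nonneg' p _
  have gG : 1 ≤ 2 - ex (bernoulliWeight p) (ind (secAt e true D)) := by
    have := one_sub_ex_ind p (secAt e true D); have := ex_ind_nonneg' p (secAt e true D)ᶜ; linarith
  have nn := mul_nonneg nA nB
  have t0 := mul_nonneg ht1 (add_nonneg c1 c2)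
  have t1 := mul_nonneg (mul_nonneg ht0 ht1)
    (add_nonneg (add_nonneg (mul_nonneg (by linarith : (0:ℝ) ≤ 2 - ex (bernoulliWeight p) (ind (secAt e true D))) nn) (mul_nonneg nA dB))
      (mul_nonneg nB dA))
  have t2 := mul_nonneg (mul_nonneg ht0 (pow_nonneg ht1 2)) (mul_nonneg nn nD)
  linarith

/-- **The pointwise statement on the class**: at interior `p`, `E_3(μ_p; A, B, D) = 0 ↔ (A, B, D) ∈ Z_3`. [this work] -/
theorem sahiE_three_absorbedPair_settled {p : ι → unitInterval} (hp : ∀ f, (p f : ℝ) ∈ Set.Ioo (0 : ℝ) 1) :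
    sahiE (bernoulliWeight p) 3 (fun j => ind ((![A, B, D] : Fin 3 → Set (Set ι)) j)) = 0 ↔ SuppZeroFlag 3 ![A, B, D] := by
  have hU : ∀ j, IsUpperSet ((![A, B, D] : Fin 3 → Set (Set ι)) j) := by
    intro j; fin_cases j
    · exact hAu
    · exact hBu
    · exact hDu
  have hv : (fun j => ind ((![A, B, D] : Fin 3 → Set (Set ι)) j)) = ![ind A, ind B, ind D] := by
    funext j; fin_cases j <;> rfl
  rw [hv]
  refine ⟨fun hz => ?_, fun hZ => ?_⟩
  swap
  · have := masterFamilyEqIff_mpr 3 ι p _ hZ; rwa [hv] at this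
  refine suppZeroFlag_of_eq_zero_on_paramBox _ hU (a := fun _ => 0) (b := fun _ => 1) (fun _ => zero_lt_one) (fun _ => le_rfl)
    (fun _ => le_rfl) fun q hq => ?_
  rw [hv]
  have ht0 : 0 < (p e : ℝ) := (hp e).1
  have ht1 : 0 < 1 - (p e : ℝ) := sub_pos.2 (hp e).2
  have hA0u := isUpperSet_secAt e false hAu
  have hB0u := isUpperSet_secAt e false hBu
  have hC := isUpperSet_secAt e false hDu
  have c1 := cov_ind_nonneg p hA0u (hB0u.inter hC)
  have c2 := cov_ind_nonneg p hB0u (hA0u.inter hC)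
  have nA := ex_secAt_true_sub_false_nonneg p e hAu
  have nB := ex_secAt_true_sub_false_nonneg p e hBu
  have nD := ex_secAt_true_sub_false_nonneg p e hDu
  have dB : 0 ≤ ex (bernoulliWeight p) (ind (secAt e false B)) - ex (bernoulliWeight p) (ind (secAt e false B ∩ secAt e false D)) := by
    rw [ex_ind_sub_of_subset _ Set.inter_subset_left]; exact ex_ind_nonneg' p _
  have dA : 0 ≤ ex (bernoulliWeight p) (ind (secAt e false A)) - ex (bernoulliWeight p) (ind (secAt e false A ∩ secAt e false D)) := by
    rw [ex_ind_sub_of_subset _ Set.inter_subset_left]; exact ex_ind_nonneg' p _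
  have gG : 1 ≤ 2 - ex (bernoulliWeight p) (ind (secAt e true D)) := by
    have := one_sub_ex_ind p (secAt e true D); have := ex_ind_nonneg' p (secAt e true D)ᶜ; linarith
  have nn := mul_nonneg nA nB
  have p1 := mul_nonneg (by linarith : (0:ℝ) ≤ 2 - ex (bernoulliWeight p) (ind (secAt e true D))) nn
  have p2 := mul_nonneg nA dB
  have p3 := mul_nonneg nB dA
  have p4 := mul_nonneg nn nD
  have hz' := hz
  rw [sahiE_three_absorbedPair_eq p e F₀ F₁ A B D hA0 hB0 hA1 hB1 hDA hDB] at hz'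
  have w0 := mul_nonneg ht1.le (add_nonneg c1 c2)
  have w1 := mul_nonneg (mul_nonneg ht0.le ht1.le) (add_nonneg (add_nonneg p1 p2) p3)
  have w2 := mul_nonneg (mul_nonneg ht0.le (pow_nonneg ht1.le 2)) p4
  have s0 : (1 - (p e : ℝ)) *
      ((ex (bernoulliWeight p) (ind (secAt e false A ∩ (secAt e false B ∩ secAt e false D))) -
          ex (bernoulliWeight p) (ind (secAt e false A)) * ex (bernoulliWeight p) (ind (secAt e false B ∩ secAt e false D)))
        + (ex (bernoulliWeight p) (ind (secAt e false B ∩ (secAt e false A ∩ secAt e false D))) -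
          ex (bernoulliWeight p) (ind (secAt e false B)) * ex (bernoulliWeight p) (ind (secAt e false A ∩ secAt e false D)))) = 0 := by
    linarith
  have s1 : (p e : ℝ) * (1 - (p e : ℝ)) *
      ((2 - ex (bernoulliWeight p) (ind (secAt e true D))) *
          ((ex (bernoulliWeight p) (ind (secAt e true A)) - ex (bernoulliWeight p) (ind (secAt e false A))) *
            (ex (bernoulliWeight p) (ind (secAt e true B)) - ex (bernoulliWeight p) (ind (secAt e false B))))
        + (ex (bernoulliWeight p) (ind (secAt e true A)) - ex (bernoulliWeight p) (ind (secAt e false A))) *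
          (ex (bernoulliWeight p) (ind (secAt e false B)) - ex (bernoulliWeight p) (ind (secAt e false B ∩ secAt e false D)))
        + (ex (bernoulliWeight p) (ind (secAt e true B)) - ex (bernoulliWeight p) (ind (secAt e false B))) *
          (ex (bernoulliWeight p) (ind (secAt e false A)) - ex (bernoulliWeight p) (ind (secAt e false A ∩ secAt e false D)))) = 0 := by
    linarith
  have s2 : (p e : ℝ) * (1 - (p e : ℝ)) ^ 2 *
      ((ex (bernoulliWeight p) (ind (secAt e true A)) - ex (bernoulliWeight p) (ind (secAt e false A))) *
        (ex (bernoulliWeight p) (ind (secAt e true B)) - ex (bernoulliWeight p) (ind (secAt e false B))) *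
        (ex (bernoulliWeight p) (ind (secAt e true D)) - ex (bernoulliWeight p) (ind (secAt e false D)))) = 0 := by
    linarith
  have s0' := (mul_eq_zero.1 s0).resolve_left ht1.ne'
  have s1' := (mul_eq_zero.1 s1).resolve_left (mul_ne_zero ht0.ne' ht1.ne')
  have s2' := (mul_eq_zero.1 s2).resolve_left (mul_ne_zero ht0.ne' (pow_ne_zero 2 ht1.ne'))
  have z1 : ex (bernoulliWeight p) (ind (secAt e false A ∩ (secAt e false B ∩ secAt e false D))) -
      ex (bernoulliWeight p) (ind (secAt e false A)) * ex (bernoulliWeight p) (ind (secAt e false B ∩ secAt e false D)) = 0 := by linarith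
  have z2 : ex (bernoulliWeight p) (ind (secAt e false B ∩ (secAt e false A ∩ secAt e false D))) -
      ex (bernoulliWeight p) (ind (secAt e false B)) * ex (bernoulliWeight p) (ind (secAt e false A ∩ secAt e false D)) = 0 := by linarith
  have z3 : (ex (bernoulliWeight p) (ind (secAt e true A)) - ex (bernoulliWeight p) (ind (secAt e false A))) *
      (ex (bernoulliWeight p) (ind (secAt e true B)) - ex (bernoulliWeight p) (ind (secAt e false B))) = 0 := by
    have h : (2 - ex (bernoulliWeight p) (ind (secAt e true D))) *
        ((ex (bernoulliWeight p) (ind (secAt e true A)) - ex (bernoulliWeight p) (ind (secAt e false A))) *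
          (ex (bernoulliWeight p) (ind (secAt e true B)) - ex (bernoulliWeight p) (ind (secAt e false B)))) = 0 := by linarith
    exact (mul_eq_zero.1 h).resolve_left (by linarith)
  have z4 : (ex (bernoulliWeight p) (ind (secAt e true A)) - ex (bernoulliWeight p) (ind (secAt e false A))) *
      (ex (bernoulliWeight p) (ind (secAt e false B)) - ex (bernoulliWeight p) (ind (secAt e false B ∩ secAt e false D))) = 0 := by linarith
  have z5 : (ex (bernoulliWeight p) (ind (secAt e true B)) - ex (bernoulliWeight p) (ind (secAt e false B))) *
      (ex (bernoulliWeight p) (ind (secAt e false A)) - ex (bernoulliWeight p) (ind (secAt e false A ∩ secAt e false D))) = 0 := by linarith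
  -- transfer
  have T1 := cov_ind_eq_zero_transfer hp q hA0u (hB0u.inter hC) z1
  have T2 := cov_ind_eq_zero_transfer hp q hB0u (hA0u.inter hC) z2
  have T3 : (ex (bernoulliWeight q) (ind (secAt e true A)) - ex (bernoulliWeight q) (ind (secAt e false A))) *
      (ex (bernoulliWeight q) (ind (secAt e true B)) - ex (bernoulliWeight q) (ind (secAt e false B))) = 0 := by
    rcases mul_eq_zero.1 z3 with h | h
    · rw [ex_secAt_sub_eq_zero_transfer hp q e hAu h, zero_mul]
    · rw [ex_secAt_sub_eq_zero_transfer hp q e hBu h, mul_zero]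
  have T4 : (ex (bernoulliWeight q) (ind (secAt e true A)) - ex (bernoulliWeight q) (ind (secAt e false A))) *
      (ex (bernoulliWeight q) (ind (secAt e false B)) - ex (bernoulliWeight q) (ind (secAt e false B ∩ secAt e false D))) = 0 := by
    rcases mul_eq_zero.1 z4 with h | h
    · rw [ex_secAt_sub_eq_zero_transfer hp q e hAu h, zero_mul]
    · rw [ex_sub_eq_zero_transfer_of_subset hp q Set.inter_subset_left h, mul_zero]
  have T5 : (ex (bernoulliWeight q) (ind (secAt e true B)) - ex (bernoulliWeight q) (ind (secAt e false B))) *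
      (ex (bernoulliWeight q) (ind (secAt e false A)) - ex (bernoulliWeight q) (ind (secAt e false A ∩ secAt e false D))) = 0 := by
    rcases mul_eq_zero.1 z5 with h | h
    · rw [ex_secAt_sub_eq_zero_transfer hp q e hBu h, zero_mul]
    · rw [ex_sub_eq_zero_transfer_of_subset hp q Set.inter_subset_left h, mul_zero]
  rw [sahiE_three_absorbedPair_eq q e F₀ F₁ A B D hA0 hB0 hA1 hB1 hDA hDB, T1, T2, T4, T5]
  have T3a : (2 - ex (bernoulliWeight q) (ind (secAt e true D))) *
      ((ex (bernoulliWeight q) (ind (secAt e true A)) - ex (bernoulliWeight q) (ind (secAt e false A))) *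
        (ex (bernoulliWeight q) (ind (secAt e true B)) - ex (bernoulliWeight q) (ind (secAt e false B)))) = 0 := by rw [T3, mul_zero]
  have T3b : (ex (bernoulliWeight q) (ind (secAt e true A)) - ex (bernoulliWeight q) (ind (secAt e false A))) *
      (ex (bernoulliWeight q) (ind (secAt e true B)) - ex (bernoulliWeight q) (ind (secAt e false B))) *
      (ex (bernoulliWeight q) (ind (secAt e true D)) - ex (bernoulliWeight q) (ind (secAt e false D))) = 0 := by rw [T3, zero_mul]
  rw [T3a, T3b]
  ring

end AbsorbedPair

end Pointwise

end Summit.CriticalPhenomena.PercolationContinuityZ3.Theorems
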